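import Summits.BirchSwinnertonDyer.BirchSwinnertonDyer.Theorems.ResidualThetaTransportAtTwoResidualSignedLambdaLowerCMAtTwoLambdaAssembly
import Mathlib
import HarnessLib

/-!
# Sketch — stub-ideation k = 1, gen 5, for `stub_cmLambdaLower` (= route item RSL_g, stmt-BirchSwinnertonDyer-22608)

Technique family of this seat: **weaken / strengthen** (weakest sufficient form / strongest provable form).
Nothing here proves BSD, RSL_g or the stub; these are HOLD-free KERNEL lemmas that make the consumer chain of
`STUB-PLAN §11.2` accept a WEAKER hold than the one currently drafted (§11.1, joint `(z, D, c)`):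

* §1 `MembershipKernel` (PLAN 1 «saturate, don't decorate»): M0–M4 — base change to `K = Frac 𝒪` of quotients
  `P ⧸ N` is ANTITONE in `N` (M1) and BLIND to sub- or super-modules of bounded `ϖ`-power (more generally: `c`-) index
  (M2, M4); hence a MEMBERSHIP explicit-reciprocity clause `(C c)·Col⁺(loc₂ z) ∈ (ι Lm)` already gives the
  `hm`-socket `d ≤ λ(Λ/(Col⁺ loc₂ z))` (M3), and the saturation tie `ϖ^m·K.Z ⊆ Λ z ⊆ K.Z` transfers the flank (M4).
* §2 `Consumer`: M5 — the landed four-term assembly `CharIdealLambda.le_finrank_baseChange_of_fourTerm` composed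
  with M3, i.e. the consumer with the membership socket, BY NAME.
* §3 `DiscreteSide` (PLAN 2): P4 — four-term exactness that holds only UP TO `c`-KILLED ERROR at the kernel spot
  becomes honest exactness after base change (flatness of `K/𝒪`); P2 — orthogonality transfers along an adjoint
  pair (res, cor); P1 — Kőnig / finite inverse systems is Mathlib's `nonempty_sections_of_finite_inverse_system`.
* §4 `Gauge` (PLAN 3): the tightness certificate — under the two-sided kernel identity (★) the gauge hold
  `∃ e, d + e ≤ nλ(Col⁺loc₂ z) ∧ λ(𝐇¹/Λz) ≤ λ(X₀) + e` is EQUIVALENT to the S2-core `d ≤ λ(X⁺_∅)` (pure arithmetic).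
-/

namespace Summit.BirchSwinnertonDyer.BirchSwinnertonDyer.Cruxes.ResidualThetaCountLowerPureAtTwo.StubCmLambdaLowerK1G5

open scoped TensorProduct
open Function

universe u v w

/-! ## §1 Membership kernel (PLAN 1) -/
section MembershipKernel

variable {A : Type u} [CommRing A] (K : Type w) [Field K] [Algebra A K]
variable {P : Type v} [AddCommGroup P] [Module A P]

/-- **M0.** Base change to `K` kills an `A`-module annihilated by some `c` that becomes a unit in `K`. -/
theorem subsingleton_baseChange_of_smul_eq_zero {Q : Type*} [AddCommGroup Q] [Module A Q] (c : A)
    (hc : IsUnit (algebraMap A K c)) (hQ : ∀ q : Q, c • q = 0) : Subsingleton (K ⊗[A] Q) := by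
  obtain ⟨u, hu⟩ := hc
  have hzero : ∀ z : K ⊗[A] Q, z = 0 := by
    intro z
    induction z using TensorProduct.induction_on with
    | zero => rfl
    | tmul k q =>
        have hk : c • ((↑u⁻¹ : K) * k) = k := by
          rw [Algebra.smul_def, ← hu, Units.mul_inv_cancel_left]
        calc k ⊗ₜ[A] q = (c • ((↑u⁻¹ : K) * k)) ⊗ₜ[A] q := by rw [hk]
          _ = ((↑u⁻¹ : K) * k) ⊗ₜ[A] (c • q) := TensorProduct.smul_tmul _ _ _
          _ = 0 := by rw [hQ, TensorProduct.tmul_zero]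
    | add x y hx hy => rw [hx, hy, add_zero]
  exact ⟨fun x y ↦ by rw [hzero x, hzero y]⟩

variable {N N' : Submodule A P}

/-- The factor map `P ⧸ N' → P ⧸ N` for `N' ≤ N`. -/
def factorQ (h : N' ≤ N) : (P ⧸ N') →ₗ[A] (P ⧸ N) :=
  N'.liftQ N.mkQ (by rwa [Submodule.ker_mkQ])

theorem factorQ_surjective (h : N' ≤ N) : Surjective (factorQ h) := by
  intro x
  obtain ⟨p, rfl⟩ := N.mkQ_surjective x
  exact ⟨N'.mkQ p, by simp [factorQ]⟩

theorem factorQ_exact (h : N' ≤ N) : Exact (N.map N'.mkQ).subtype (factorQ h) := by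
  rw [LinearMap.exact_iff, Submodule.range_subtype]
  simp only [factorQ, Submodule.ker_liftQ, Submodule.ker_mkQ]

/-- **M1 (antitone).** `N' ≤ N ⇒ dim_K K ⊗ (P ⧸ N) ≤ dim_K K ⊗ (P ⧸ N')`. -/
theorem finrank_baseChange_quotient_anti (h : N' ≤ N) [Module.Finite K (K ⊗[A] (P ⧸ N'))] :
    Module.finrank K (K ⊗[A] (P ⧸ N)) ≤ Module.finrank K (K ⊗[A] (P ⧸ N')) := by
  have hs : Surjective ((factorQ h).baseChange K) := by
    rw [LinearMap.baseChange_eq_ltensor]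
    exact LinearMap.lTensor_surjective K (factorQ_surjective h)
  calc Module.finrank K (K ⊗[A] (P ⧸ N))
      = Module.finrank K (LinearMap.range ((factorQ h).baseChange K)) := by
        rw [LinearMap.range_eq_top.mpr hs, finrank_top]
    _ ≤ Module.finrank K (K ⊗[A] (P ⧸ N')) := LinearMap.finrank_range_le _

/-- **M2 (constants wash out), as an equivalence.** If `N' ≤ N` and `c • N ⊆ N'` with `c` a unit in `K`, the factor
map induces `K ⊗ (P ⧸ N') ≃ K ⊗ (P ⧸ N)`. -/
noncomputable def baseChangeQuotientEquiv (c : A) (hc : IsUnit (algebraMap A K c)) (h₁ : N' ≤ N)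
    (h₂ : ∀ n ∈ N, c • n ∈ N') : K ⊗[A] (P ⧸ N') ≃ₗ[K] K ⊗[A] (P ⧸ N) := by
  refine LinearEquiv.ofBijective ((factorQ h₁).baseChange K) ⟨?_, ?_⟩
  · have hQ : ∀ q : N.map N'.mkQ, c • q = 0 := by
      intro q
      obtain ⟨n, hn, hq⟩ := Submodule.mem_map.mp q.2
      rw [Subtype.ext_iff, Submodule.coe_smul, Submodule.coe_zero, ← hq, Submodule.mkQ_apply,
        ← Submodule.Quotient.mk_smul, Submodule.Quotient.mk_eq_zero]
      exact h₂ n hn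
    haveI := subsingleton_baseChange_of_smul_eq_zero K (Q := ↥(N.map N'.mkQ)) c hc hQ
    have hex := lTensor_exact K (factorQ_exact h₁) (factorQ_surjective h₁)
    have h0 : (N.map N'.mkQ).subtype.lTensor K = 0 := by
      apply LinearMap.ext
      intro x
      rw [Subsingleton.elim x 0, map_zero, LinearMap.zero_apply]
    show Injective ((factorQ h₁).baseChange K : K ⊗[A] (P ⧸ N') → K ⊗[A] (P ⧸ N))
    rw [LinearMap.baseChange_eq_ltensor, ← LinearMap.ker_eq_bot, LinearMap.exact_iff.mp hex, h0,
      LinearMap.range_zero]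
  · show Surjective ((factorQ h₁).baseChange K : K ⊗[A] (P ⧸ N') → K ⊗[A] (P ⧸ N))
    rw [LinearMap.baseChange_eq_ltensor]
    exact LinearMap.lTensor_surjective K (factorQ_surjective h₁)

/-- **M2.** `N' ≤ N`, `c • N ⊆ N'`, `c` a unit in `K` ⇒ equal `K`-dimensions of `K ⊗ (P ⧸ N')` and `K ⊗ (P ⧸ N)`. -/
theorem finrank_baseChange_quotient_eq_of_smul_le (c : A) (hc : IsUnit (algebraMap A K c)) (h₁ : N' ≤ N)
    (h₂ : ∀ n ∈ N, c • n ∈ N') :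
    Module.finrank K (K ⊗[A] (P ⧸ N')) = Module.finrank K (K ⊗[A] (P ⧸ N)) :=
  (baseChangeQuotientEquiv K c hc h₁ h₂).finrank_eq

theorem finite_baseChange_quotient_of_smul_le (c : A) (hc : IsUnit (algebraMap A K c)) (h₁ : N' ≤ N)
    (h₂ : ∀ n ∈ N, c • n ∈ N') [Module.Finite K (K ⊗[A] (P ⧸ N))] :
    Module.Finite K (K ⊗[A] (P ⧸ N')) :=
  Module.Finite.equiv (baseChangeQuotientEquiv K c hc h₁ h₂).symm

/-- **M3 (membership ⇒ the `hm` socket).** If `c • M ⊆ N` with `c` a unit in `K` — e.g. `M = (G)`, `N = (L)` and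
`(C c)·G ∈ (L)` (a MEMBERSHIP explicit reciprocity law, `G = Col⁺_g(loc₂ z)`, `L = ι Lm`) — then
`dim_K K ⊗ (P ⧸ N) ≤ dim_K K ⊗ (P ⧸ M)`, i.e. `d = λ(Λ/(Lm)) ≤ λ(Λ/(Col⁺ loc₂ z))`.  No unit, no equality, no
decoration `D` is needed on the input side. -/
theorem finrank_baseChange_quotient_le_of_smul_mem (c : A) (hc : IsUnit (algebraMap A K c))
    {M N : Submodule A P} (hmem : ∀ m ∈ M, c • m ∈ N) [Module.Finite K (K ⊗[A] (P ⧸ M))] :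
    Module.finrank K (K ⊗[A] (P ⧸ N)) ≤ Module.finrank K (K ⊗[A] (P ⧸ M)) := by
  have hMN : ∀ m ∈ M, c • m ∈ M ⊓ N := fun m hm ↦ Submodule.mem_inf.mpr ⟨M.smul_mem c hm, hmem m hm⟩
  haveI : Module.Finite K (K ⊗[A] (P ⧸ (M ⊓ N))) :=
    finite_baseChange_quotient_of_smul_le K c hc inf_le_left hMN
  calc Module.finrank K (K ⊗[A] (P ⧸ N)) ≤ Module.finrank K (K ⊗[A] (P ⧸ (M ⊓ N))) :=
        finrank_baseChange_quotient_anti K inf_le_right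
    _ = Module.finrank K (K ⊗[A] (P ⧸ M)) :=
        finrank_baseChange_quotient_eq_of_smul_le K c hc inf_le_left hMN

/-- **M4 (saturation transfer of the flank).** If `Z ≤ Zsat` and `c • Zsat ⊆ Z` (`K.Z` versus its `ϖ`-saturation,
or versus `Λ·z` for a generator `z` of `K.Z ⊗ ℚ`), then `λ(P/Z) = λ(P/Zsat)`: the `(ii)`-clause may be cited for
whichever of the two print states it. -/
theorem finrank_baseChange_quotient_eq_of_saturation (c : A) (hc : IsUnit (algebraMap A K c))
    {Z Zsat : Submodule A P} (h₁ : Z ≤ Zsat) (h₂ : ∀ y ∈ Zsat, c • y ∈ Z) :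
    Module.finrank K (K ⊗[A] (P ⧸ Z)) = Module.finrank K (K ⊗[A] (P ⧸ Zsat)) :=
  finrank_baseChange_quotient_eq_of_smul_le K c hc h₁ h₂

/-- Bridge: for a `Λ`-submodule `M` (any `A`-algebra `Λ`), the `Λ`-quotient and the `A`-quotient have the same base
change dimension (so M1–M4, stated for `A`-submodules, apply to `Λ`-submodules via `restrictScalars`). -/
theorem finrank_baseChange_restrictScalars_quotient {R : Type*} [CommRing R] [Algebra A R] {P' : Type v}
    [AddCommGroup P'] [Module R P'] [Module A P'] [IsScalarTower A R P'] (M : Submodule R P') :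
    Module.finrank K (K ⊗[A] (P' ⧸ M.restrictScalars A)) = Module.finrank K (K ⊗[A] (P' ⧸ M)) :=
  ((Submodule.Quotient.restrictScalarsEquiv A M).baseChange A K _ _).finrank_eq

end MembershipKernel

/-! ## §2 The consumer with the membership socket (PLAN 1, by name on the landed kit) -/
section Consumer

open Summit.BirchSwinnertonDyer.BirchSwinnertonDyer.Theorems.CharIdealLambda

variable {A : Type u} [CommRing A] [IsDomain A] [IsDiscreteValuationRing A]
  [IsAdicComplete (IsLocalRing.maximalIdeal A) A]
variable (K : Type w) [Field K] [Algebra A K] [IsFractionRing A K]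
variable {H1Z Q X X0 P : Type v}
  [AddCommGroup H1Z] [Module A H1Z]
  [AddCommGroup Q] [Module (PowerSeries A) Q] [Module A Q] [IsScalarTower A (PowerSeries A) Q]
  [Module.Finite (PowerSeries A) Q]
  [AddCommGroup X] [Module (PowerSeries A) X] [Module A X] [IsScalarTower A (PowerSeries A) X]
  [Module.Finite (PowerSeries A) X]
  [AddCommGroup X0] [Module A X0]
  [AddCommGroup P] [Module A P]

/-- **M5 (consumer ∘ M3).** The landed four-term assembly `le_finrank_baseChange_of_fourTerm` with its `hm` socket fed
by a MEMBERSHIP reciprocity clause: `Q ≅ P ⧸ M` (`P = Λ` or `H¹_{/+}`, `M = (Col⁺ loc₂ z)`), `c • M ⊆ N` (`N = (ι Lm)`),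
`m ≤ λ(P ⧸ N)` (`= d`, p625410) and the flank `λ(𝐇¹/Λz) ≤ λ(X₀)` give `m ≤ λ(X)`. -/
theorem le_finrank_baseChange_of_fourTerm_of_smul_mem (hQ : Module.IsTorsion (PowerSeries A) Q)
    (hX : Module.IsTorsion (PowerSeries A) X) (f : H1Z →ₗ[A] Q) (g : Q →ₗ[A] X) (h : X →ₗ[A] X0)
    (hf : Injective f) (hfg : Exact f g) (hgh : Exact g h) (hh : Surjective h)
    {M N : Submodule A P} (e : Q ≃ₗ[A] (P ⧸ M)) {c : A} (hc : c ≠ 0) (hmem : ∀ m ∈ M, c • m ∈ N)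
    {m : ℕ} (hm : m ≤ Module.finrank K (K ⊗[A] (P ⧸ N)))
    (hflank : Module.finrank K (K ⊗[A] H1Z) ≤ Module.finrank K (K ⊗[A] X0)) :
    m ≤ Module.finrank K (K ⊗[A] X) := by
  have hcK : IsUnit (algebraMap A K c) :=
    isUnit_iff_ne_zero.mpr ((map_ne_zero_iff (algebraMap A K) (IsFractionRing.injective A K)).mpr hc)
  haveI : Module.Finite K (K ⊗[A] Q) := finite_baseChange_of_isTorsion K Q hQ
  haveI : Module.Finite K (K ⊗[A] (P ⧸ M)) := Module.Finite.equiv (e.baseChange A K _ _)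
  refine le_finrank_baseChange_of_fourTerm K hQ hX f g h hf hfg hgh hh (hm.trans ?_) hflank
  rw [(e.baseChange A K _ _).finrank_eq]
  exact finrank_baseChange_quotient_le_of_smul_mem K c hcK hmem

end Consumer

/-! ## §3 Discrete-side `hQ` (PLAN 2): error-tolerant exactness, adjoint orthogonality, Kőnig -/
section DiscreteSide

variable {A : Type u} [CommRing A] (K : Type w) [Field K] [Algebra A K]
variable {V Q X : Type*} [AddCommGroup V] [Module A V] [AddCommGroup Q] [Module A Q] [AddCommGroup X] [Module A X]

/-- **P4 (λ-null tolerance).** If `V → Q → X` is a complex whose homology at `Q` is killed by some `c` that is a unit in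
`K` (every finite-level Poitou–Tate defect of uniformly bounded exponent is of this kind), then after base change to a
FLAT `K` (e.g. `K = Frac A`) the pair is honestly exact — so the kit's `hQ : ker g ≤ range f` need only be ported
up to bounded `ϖ`-power error. -/
theorem exact_baseChange_of_smul_ker_le_range [Module.Flat A K] (c : A) (hc : IsUnit (algebraMap A K c))
    (f : V →ₗ[A] Q) (g : Q →ₗ[A] X) (hcomp : ∀ v, g (f v) = 0)
    (herr : ∀ q ∈ LinearMap.ker g, c • q ∈ LinearMap.range f) :
    Exact (f.lTensor K) (g.lTensor K) := by
  obtain ⟨u, hu⟩ := hc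
  have h1 := Module.Flat.lTensor_exact K (LinearMap.exact_subtype_ker_map g)
  rw [LinearMap.exact_iff] at h1 ⊢
  apply le_antisymm
  · rw [h1]
    rintro _ ⟨t, rfl⟩
    induction t using TensorProduct.induction_on with
    | zero => simp
    | tmul k q =>
        obtain ⟨v, hv⟩ := herr q q.2
        refine ⟨((↑u⁻¹ : K) * k) ⊗ₜ[A] v, ?_⟩
        have hk : c • ((↑u⁻¹ : K) * k) = k := by
          rw [Algebra.smul_def, ← hu, Units.mul_inv_cancel_left]
        rw [LinearMap.lTensor_tmul, LinearMap.lTensor_tmul, hv, ← TensorProduct.smul_tmul, hk,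
          Submodule.subtype_apply]
    | add x y hx hy => rw [map_add]; exact add_mem hx hy
  · rintro _ ⟨t, rfl⟩
    rw [LinearMap.mem_ker, ← LinearMap.comp_apply, ← LinearMap.lTensor_comp]
    have : g ∘ₗ f = 0 := LinearMap.ext hcomp
    rw [this, LinearMap.lTensor_zero, LinearMap.zero_apply]

/-- `K = Frac A` is flat over `A` (so P4 applies with the kit's `K`). -/
theorem flat_fractionRing {A : Type u} [CommRing A] (K : Type w) [CommRing K] [Algebra A K]
    [IsFractionRing A K] : Module.Flat A K :=
  IsLocalization.flat K (nonZeroDivisors A)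

/-- **P2 (orthogonality transfers along an adjoint pair).** With `⟨t, cor y⟩ₙ = ⟨res t, y⟩ₘ` (projection formula for
the local Tate pairings in the tower), `t ⟂ cor(Yₘ)` iff `res t ⟂ Yₘ` — the step that turns Λ-adic orthogonality
(against the image of `𝐇¹(T)`, an inverse limit along `cor`) into finite-level orthogonality where finite
Poitou–Tate (`SelmerComplement`, tree) applies. Pure algebra. -/
theorem orthogonal_cor_iff_orthogonal_res {Tn Tm Yn Ym C : Type*} (pairN : Tn → Yn → C) (pairM : Tm → Ym → C)
    (res : Tn → Tm) (cor : Ym → Yn) (zero : C) (adj : ∀ t y, pairN t (cor y) = pairM (res t) y) (t : Tn) :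
    (∀ y, pairN t (cor y) = zero) ↔ ∀ y, pairM (res t) y = zero := by
  simp only [adj]

/-- **P1 (eventual image = image of the limit)** is Mathlib's Kőnig lemma for inverse systems of nonempty finite
sets (`nonempty_sections_of_finite_inverse_system`), applied to the fibres over a fixed finite-level class. -/
example := @nonempty_sections_of_finite_inverse_system

end DiscreteSide

/-! ## §4 Gauge / tightness certificate (PLAN 3) -/
section Gauge

/-- **Tightness certificate.** Under the two-sided kernel identity (★) `λ(X) + λ(𝐇¹/Λz) = nλ(Col⁺loc₂ z) + λ(X₀)`
(Poitou–Tate four-term sequence with BOTH ends, `Col⁺` onto, free rank one), the two-clause gauge hold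
`∃ e, d + e ≤ nλ(Col⁺loc₂ z) ∧ λ(𝐇¹/Λz) ≤ λ(X₀) + e` is EQUIVALENT to `S2-core ∧ d ≤ nλ(Col⁺loc₂ z)`.  Read: any
two-clause interface costs exactly the membership clause (i) `d ≤ nλ(Col⁺loc₂ z)` on top of S2 itself; clause (ii)
cannot be weakened below the one-sided BT26 inequality for the SAME `z` except by the slack that (i) over-delivers;
and the only hold weaker than both clauses is the sum inequality, which under (★) IS S2 (a costume). -/
theorem gauge_iff_core (d n h x0 x : ℕ) (star : x + h = n + x0) :
    (∃ e, d + e ≤ n ∧ h ≤ x0 + e) ↔ (d ≤ x ∧ d ≤ n) := by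
  constructor
  · rintro ⟨e, h1, h2⟩
    exact ⟨by omega, by omega⟩
  · rintro ⟨hd, hn⟩
    exact ⟨n - d, by omega, by omega⟩

/-- One-sided use (what the consumer actually does, HOLD-free half of (★) only):
`nλ(Col⁺loc₂ z) + λ(X₀) ≤ λ(X) + λ(𝐇¹/Λz)` plus the two clauses gives the core. -/
theorem core_of_gauge_oneSided (d n h x0 x : ℕ) (half : n + x0 ≤ x + h) (e : ℕ) (h1 : d + e ≤ n)
    (h2 : h ≤ x0 + e) : d ≤ x := by
  omega

end Gauge

end Summit.BirchSwinnertonDyer.BirchSwinnertonDyer.Cruxes.ResidualThetaCountLowerPureAtTwo.StubCmLambdaLowerK1G5
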